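import Mathlib
import HarnessLib
import Summits.Ventures.LatticeQCDFlow.Scoring.BatchMeansMartingaleCLT
import Summits.Ventures.LatticeQCDFlow.Scoring.BatchMeansCLTRemainder
import Summits.Ventures.LatticeQCDFlow.Scoring.DoeblinPowerGeometricEnvelope

/-!
# THE CENTRAL LIMIT THEOREM FOR THE BATCH-MEANS ESTIMATOR OF THE ASYMPTOTIC VARIANCE, from any
# start: `√a_n (σ̂²_{a_n,b_n} − σ²_f) ⇒ N(0, 2σ⁴_f)` whenever `a_n, b_n → ∞` and `a_n/b_n² → 0`

HONEST FRAMING: exact (Metropolis-corrected) sampling algorithms for lattice gauge theory;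
figures of merit are autocorrelation/cost numbers at stated couplings and volumes; no
continuum-physics claim.

Venture `LatticeQCDFlow` (cell pub-lqcd), topic `Scoring`; FANOUT row 4 (`s0-u1-b`, GEN-30).
NEW WORK of the cell, not a published result; no definition is introduced; nothing is cited as a
fact.  THE SAMPLING LAW OF THE ERROR BAR.  `κ` a Markov kernel with invariant probability `π`
under row 8's geometric sup-norm envelope (`|(kop κ)^[t] g − πg| ≤ 2 C_g A ρ^t`; every Doeblin power
`(nHit κ m)(x,·) ≥ ε ν` gives one, `Scoring/DoeblinPowerGeometricEnvelope.lean`), `|f| ≤ C`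
measurable, `σ²_f = ∫ f̄² dπ + 2 Σ_{k≥0} ∫ f̄ (kop κ)^[k+1] f̄ dπ` the Green–Kubo (integrated
autocorrelation) variance, `σ̂²_{a,b} = ab · SE²_BM` the non-overlapping batch-means estimator from
`a` batches of length `b` (`Scoring/BatchMeans*.lean`: consistent whenever `a, b → ∞`).  THE THEOREM:
for EVERY initial law `μ₀` and all sequences `a_n → ∞`, `b_n → ∞` with `a_n/b_n² → 0`,
`√a_n (σ̂²_{a_n,b_n} − σ²_f)` converges in distribution to `N(0, 2σ⁴_f)` — the relative error of the
reported asymptotic variance (equivalently of `τ̂_int`) is asymptotically Gaussian with standard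
deviation `√(2/a_n)`, whatever the kernel's details.  Proof: `σ²_f = π(q)` for the Poisson solution
`h` (`Scoring/GeometricEnvelopeBlockSumMoments`); the centred squared block martingales converge to
`N(0, 2σ⁴_f)` (`Scoring/BatchMeansMartingaleCLT.lean`: McLeish's array CLT with the block Markov
property for the quadratic variation); the remainder is `O(1/√b + √a/b + √a/(a−1))` in `L¹`
uniformly in the start (`Scoring/BatchMeansCLTRemainder.lean`), hence `→ 0` in probability exactly
when `a/b² → 0`; `MeasureTheory.tendstoInDistribution_of_tendstoInMeasure_sub`.  The condition
`a_n/b_n² → 0` is where the `O(1/b)` bias of batch means is invisible at the scale `1/√a`; in the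
MSE-optimal regime `b ~ N^{1/3}` the limit law is shifted (row 8's leading-bias files), NOT CLAIMED
here.  Printed counterparts NAMED ONLY: asymptotic normality of batch-means / spectral variance
estimators (Damerdji 1991, 1995; Flegal–Jones 2010 §2), nothing cited as a fact.

## Content (`N_n = a_n b_n`; `σ̂²_n = a_n b_n · SE²_BM`)

* **`chain_batchMeans_sigmaHat_clt_of_envelope`** — for `Y ~ N(0, 2σ⁴_f)`:
  `TendstoInDistribution (fun n x => √a_n (σ̂²_n(x) − σ²_f)) atTop Y (fun _ => P_{μ₀}) P'`;
* **`chain_batchMeans_sigmaHat_clt_of_nHit`** — the same for every kernel with a Doeblin power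
  `(nHit κ m)(x, ·) ≥ ε ν` (`0 < ε ≤ 1`, `0 < m`).

NOT CLAIMED: the regime `a_n/b_n² ↛ 0` (biased limit); studentisation by `σ̂²√(2/a)` and the
two-code `τ_int` test (immediate corollaries, left to the next file); rates; unbounded `f`.
-/

noncomputable section

namespace Summit.Ventures.LatticeQCDFlow.Scoring

open MeasureTheory ProbabilityTheory Filter Finset Preorder
open scoped ENNReal Topology

variable {Ω : Type*} [MeasurableSpace Ω]

section Envelope

variable {κ : Kernel Ω Ω} [IsMarkovKernel κ] {π : Measure Ω} [IsProbabilityMeasure π] {A ρ : ℝ}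

/-- **THE CLT FOR THE BATCH-MEANS ESTIMATOR, FROM ANY START (geometric envelope).**  `π` invariant,
envelope `(A, ρ)` (`0 ≤ A`, `0 ≤ ρ < 1`), `|f| ≤ C` measurable; `a_n → ∞`, `b_n → ∞`, `a_n/b_n² → 0`;
`μ₀` ANY initial law.  For every `Y` with law `N(0, 2 σ⁴_f)`:
`√a_n (a_n b_n · SE²_BM − σ²_f) ⇒ Y`. -/
theorem chain_batchMeans_sigmaHat_clt_of_envelope (hπ : Kernel.Invariant κ π)
    (henv : ∀ (g : Ω → ℝ), Measurable g → ∀ (Cg : ℝ), (∀ x, |g x| ≤ Cg) →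
      ∀ (t : ℕ) (x : Ω), |(kop κ)^[t] g x - ∫ y, g y ∂π| ≤ 2 * Cg * (A * ρ ^ t))
    (hA : 0 ≤ A) (hρ0 : 0 ≤ ρ) (hρ1 : ρ < 1)
    {f : Ω → ℝ} (hf : Measurable f) {C : ℝ} (hC : ∀ x, |f x| ≤ C)
    (μ₀ : Measure Ω) [IsProbabilityMeasure μ₀] {a b : ℕ → ℕ} (ha : Tendsto a atTop atTop)
    (hb : Tendsto b atTop atTop) (hab : Tendsto (fun n => (a n : ℝ) / (b n : ℝ) ^ 2) atTop (𝓝 0))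
    {Ω' : Type*} [MeasurableSpace Ω'] {P' : Measure Ω'} [IsProbabilityMeasure P'] {Y : Ω' → ℝ}
    (hY : HasLaw Y (gaussianReal 0 (Real.toNNReal (2 * ((∫ y, (f y - ∫ z, f z ∂π) ^ 2 ∂π)
      + 2 * ∑' k, ∫ y, (f y - ∫ z, f z ∂π)
        * (kop κ)^[k + 1] (fun y => f y - ∫ z, f z ∂π) y ∂π) ^ 2))) P')
    [IsProbabilityMeasure (Kernel.trajMeasure (X := fun _ : ℕ => Ω) (μ₀)
          (fun n : ℕ => κ.comap (fun h' : (i : ↥(Finset.Iic n)) → Ω => h' ⟨n, Finset.mem_Iic.2 le_rfl⟩)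
            (measurable_pi_apply _)))] :
    TendstoInDistribution (fun (n : ℕ) (x : ℕ → Ω) =>
        Real.sqrt (a n) * (((b n * a n : ℕ) : ℝ)
          * replicaSEsq (fun j (x : ℕ → Ω) => (∑ i ∈ Finset.range (b n), f (x (b n * j + i))) / (b n))
            (a n) x
          - ((∫ y, (f y - ∫ z, f z ∂π) ^ 2 ∂π)
            + 2 * ∑' k, ∫ y, (f y - ∫ z, f z ∂π)
              * (kop κ)^[k + 1] (fun y => f y - ∫ z, f z ∂π) y ∂π)))
      atTop Y (fun _ => (Kernel.trajMeasure (X := fun _ : ℕ => Ω) (μ₀)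
            (fun n : ℕ => κ.comap (fun h' : (i : ↥(Finset.Iic n)) → Ω => h' ⟨n, Finset.mem_Iic.2 le_rfl⟩)
              (measurable_pi_apply _)))) P' := by
  set P := (Kernel.trajMeasure (X := fun _ : ℕ => Ω) (μ₀)
        (fun n : ℕ => κ.comap (fun h' : (i : ↥(Finset.Iic n)) → Ω => h' ⟨n, Finset.mem_Iic.2 le_rfl⟩)
          (measurable_pi_apply _))) with hP
  set σ2 := (∫ y, (f y - ∫ z, f z ∂π) ^ 2 ∂π)
      + 2 * ∑' k, ∫ y, (f y - ∫ z, f z ∂π) * (kop κ)^[k + 1] (fun y => f y - ∫ z, f z ∂π) y ∂π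
    with hσ2
  have h1ρ : 0 < 1 - ρ := sub_pos.2 hρ1
  -- the Poisson solution and `σ² = π(q)`
  obtain ⟨h, hh, hCh, hpois⟩ := poisson_exists_of_geometricEnvelope henv hρ0 hρ1 hf hC
  have hm : ∫ y, (kop κ (fun y => h y ^ 2) y - (kop κ h y) ^ 2) ∂π = σ2 :=
    poisson_condVar_integral_eq_greenKubo_of_envelope hπ henv hρ0 hρ1 hf hC hh hCh hpois
  -- the martingale part
  have hY' : HasLaw Y (gaussianReal 0 (Real.toNNReal (2 * (∫ y, (kop κ (fun y => h y ^ 2) y - (kop κ h y) ^ 2) ∂π) ^ 2))) P' := by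
    rw [hm]; exact hY
  have hTA := chain_sqBlockMartingale_centred_clt_of_envelope henv hA hρ0 hρ1 hh hCh μ₀ ha hb hY'
  -- measurability of the two statistics
  have hFm : ∀ n, Measurable fun x : ℕ → Ω => Real.sqrt (a n) * (((b n * a n : ℕ) : ℝ)
      * replicaSEsq (fun j (x : ℕ → Ω) => (∑ i ∈ Finset.range (b n), f (x (b n * j + i))) / (b n))
        (a n) x - σ2) := fun n =>
    ((measurable_batchMeans_sigmaHat hf (a n) (b n)).sub_const _).const_mul _
  obtain ⟨hqm, hqb⟩ := kopCondVar_bounded_measurable κ hh hCh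
  have hTm : ∀ n, Measurable fun x : ℕ → Ω =>
      (∑ j ∈ Finset.range (a n), ((∑ r ∈ Finset.range (b n), (h (x (b n * j + r + 1)) - kop κ h (x (b n * j + r)))) ^ 2
        - ∑ i ∈ Finset.range (b n), (kop κ (fun y => h y ^ 2) (x (b n * j + i)) - (kop κ h (x (b n * j + i))) ^ 2))) / (Real.sqrt (a n) * (b n)) := fun n =>
    (Finset.measurable_sum _ fun j _ => ((blockMartingale_measurable κ hh _ _).pow_const 2).sub
      (Finset.measurable_sum _ fun i _ => hqm.comp (measurable_pi_apply _))).div_const _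
  -- the remainder tends to zero in probability
  have hε : Tendsto (fun n : ℕ =>
      (Real.sqrt 10 * (4 * (4 * C * A / (1 - ρ)) ^ 2 * A / (1 - ρ)) + 6 * (4 * C * A / (1 - ρ)) ^ 2)
          / Real.sqrt (b n)
        + (2 * (4 * (4 * C * A / (1 - ρ)) ^ 2 * A / (1 - ρ)) + 4 * (4 * C * A / (1 - ρ)) ^ 2)
          * Real.sqrt (a n) / b n
        + 20 * (4 * C * A / (1 - ρ)) ^ 2 * Real.sqrt (a n) / ((a n : ℝ) - 1)) atTop (𝓝 0) := by
    have t1 : Tendsto (fun n : ℕ => (Real.sqrt 10 * (4 * (4 * C * A / (1 - ρ)) ^ 2 * A / (1 - ρ))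
        + 6 * (4 * C * A / (1 - ρ)) ^ 2) / Real.sqrt (b n)) atTop (𝓝 0) :=
      tendsto_const_nhds.div_atTop (Real.tendsto_sqrt_atTop.comp
        ((tendsto_natCast_atTop_atTop (R := ℝ)).comp hb))
    -- `√a/b = √(a/b²) → 0`
    have t2' : Tendsto (fun n : ℕ => Real.sqrt (a n) / b n) atTop (𝓝 0) := by
      have h0 := (Real.continuous_sqrt.tendsto 0).comp hab
      rw [Real.sqrt_zero] at h0
      refine h0.congr' ?_
      filter_upwards [hb.eventually_ge_atTop 1] with n hn
      have hbn : (0 : ℝ) < b n := by exact_mod_cast hn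
      show Real.sqrt ((a n : ℝ) / (b n : ℝ) ^ 2) = Real.sqrt (a n) / b n
      rw [Real.sqrt_div' _ (by positivity), Real.sqrt_sq hbn.le]
    have t2 : Tendsto (fun n : ℕ => (2 * (4 * (4 * C * A / (1 - ρ)) ^ 2 * A / (1 - ρ))
        + 4 * (4 * C * A / (1 - ρ)) ^ 2) * Real.sqrt (a n) / b n) atTop (𝓝 0) := by
      have h2 := t2'.const_mul (2 * (4 * (4 * C * A / (1 - ρ)) ^ 2 * A / (1 - ρ))
        + 4 * (4 * C * A / (1 - ρ)) ^ 2)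
      rw [mul_zero] at h2
      exact h2.congr fun n => by ring
    -- `√a/(a−1) ≤ 2/√a → 0`
    have t3' : Tendsto (fun n : ℕ => Real.sqrt (a n) / ((a n : ℝ) - 1)) atTop (𝓝 0) := by
      have h0 : Tendsto (fun n : ℕ => 2 / Real.sqrt (a n)) atTop (𝓝 0) :=
        tendsto_const_nhds.div_atTop (Real.tendsto_sqrt_atTop.comp
          ((tendsto_natCast_atTop_atTop (R := ℝ)).comp ha))
      refine squeeze_zero' ?_ ?_ h0
      · filter_upwards [ha.eventually_ge_atTop 2] with n hn
        have : (2 : ℝ) ≤ a n := by exact_mod_cast hn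
        exact div_nonneg (Real.sqrt_nonneg _) (by linarith)
      · filter_upwards [ha.eventually_ge_atTop 2] with n hn
        have h2 : (2 : ℝ) ≤ a n := by exact_mod_cast hn
        have hs : 0 < Real.sqrt (a n) := Real.sqrt_pos.2 (by linarith)
        have hss : Real.sqrt (a n) * Real.sqrt (a n) = a n := Real.mul_self_sqrt (by linarith)
        rw [div_le_div_iff₀ (by linarith) hs]
        nlinarith [hss]
    have t3 : Tendsto (fun n : ℕ => 20 * (4 * C * A / (1 - ρ)) ^ 2 * Real.sqrt (a n)
        / ((a n : ℝ) - 1)) atTop (𝓝 0) := by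
      have h3 := t3'.const_mul (20 * (4 * C * A / (1 - ρ)) ^ 2)
      rw [mul_zero] at h3
      exact h3.congr fun n => by ring
    simpa using (t1.add t2).add t3
  have hdiff : TendstoInMeasure P
      ((fun (n : ℕ) (x : ℕ → Ω) => Real.sqrt (a n) * (((b n * a n : ℕ) : ℝ)
          * replicaSEsq (fun j (x : ℕ → Ω) => (∑ i ∈ Finset.range (b n), f (x (b n * j + i))) / (b n))
            (a n) x - σ2))
        - fun (n : ℕ) (x : ℕ → Ω) =>
          (∑ j ∈ Finset.range (a n), ((∑ r ∈ Finset.range (b n), (h (x (b n * j + r + 1)) - kop κ h (x (b n * j + r)))) ^ 2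
            - ∑ i ∈ Finset.range (b n), (kop κ (fun y => h y ^ 2) (x (b n * j + i)) - (kop κ h (x (b n * j + i))) ^ 2))) / (Real.sqrt (a n) * (b n)))
      atTop 0 := by
    rw [tendstoInMeasure_iff_measureReal_norm]
    intro δ hδ
    have hε' : Tendsto (fun n : ℕ =>
        ((Real.sqrt 10 * (4 * (4 * C * A / (1 - ρ)) ^ 2 * A / (1 - ρ)) + 6 * (4 * C * A / (1 - ρ)) ^ 2)
            / Real.sqrt (b n)
          + (2 * (4 * (4 * C * A / (1 - ρ)) ^ 2 * A / (1 - ρ)) + 4 * (4 * C * A / (1 - ρ)) ^ 2)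
            * Real.sqrt (a n) / b n
          + 20 * (4 * C * A / (1 - ρ)) ^ 2 * Real.sqrt (a n) / ((a n : ℝ) - 1)) / δ) atTop (𝓝 0) := by
      simpa using hε.div_const δ
    refine squeeze_zero' (Eventually.of_forall fun n => measureReal_nonneg) ?_ hε'
    filter_upwards [ha.eventually_ge_atTop 2, hb.eventually_ge_atTop 1] with n hna hnb
    have hbn : b n ≠ 0 := by omega
    have hL1 := chain_batchMeans_scaled_sub_martingalePart_integral_abs_le_of_envelope henv hA hρ0
      hρ1 hf hC hh hCh hpois μ₀ hna hbn
    rw [← hP, hm] at hL1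
    -- Markov
    set D : (ℕ → Ω) → ℝ := fun x => Real.sqrt (a n) * (((b n * a n : ℕ) : ℝ)
        * replicaSEsq (fun j (x : ℕ → Ω) => (∑ i ∈ Finset.range (b n), f (x (b n * j + i))) / (b n))
          (a n) x - σ2)
      - (∑ j ∈ Finset.range (a n), ((∑ r ∈ Finset.range (b n), (h (x (b n * j + r + 1)) - kop κ h (x (b n * j + r)))) ^ 2
          - ∑ i ∈ Finset.range (b n), (kop κ (fun y => h y ^ 2) (x (b n * j + i)) - (kop κ h (x (b n * j + i))) ^ 2))) / (Real.sqrt (a n) * (b n)) with hD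
    have hDm : Measurable D := (hFm n).sub (hTm n)
    have hset : {x : ℕ → Ω | δ ≤ ‖((fun (n : ℕ) (x : ℕ → Ω) => Real.sqrt (a n) * (((b n * a n : ℕ) : ℝ)
          * replicaSEsq (fun j (x : ℕ → Ω) => (∑ i ∈ Finset.range (b n), f (x (b n * j + i))) / (b n))
            (a n) x - σ2))
        - fun (n : ℕ) (x : ℕ → Ω) =>
          (∑ j ∈ Finset.range (a n), ((∑ r ∈ Finset.range (b n), (h (x (b n * j + r + 1)) - kop κ h (x (b n * j + r)))) ^ 2
            - ∑ i ∈ Finset.range (b n), (kop κ (fun y => h y ^ 2) (x (b n * j + i)) - (kop κ h (x (b n * j + i))) ^ 2))) / (Real.sqrt (a n) * (b n))) n x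
          - (0 : (ℕ → Ω) → ℝ) x‖} = {x | δ ≤ |D x|} := by
      ext x; simp only [Set.mem_setOf_eq, Pi.sub_apply, Pi.zero_apply, sub_zero, Real.norm_eq_abs, hD]
    rw [hset]
    -- `|D|` is integrable: bounded by the finite `L¹` bound? No — bounded pointwise as a finite sum of
    -- bounded terms; we use integrability from the `L¹` estimate's integrand being bounded measurable.
    have hDint : Integrable (fun x => |D x|) P := by
      have hbR : (0 : ℝ) < b n := by exact_mod_cast (show 0 < b n by omega)
      have haR : (0 : ℝ) < a n := by exact_mod_cast (show 0 < a n by omega)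
      refine (integrable_of_bounded P hDm (C := Real.sqrt (a n) * (4 * (b n) * C ^ 2 + |σ2|)
        + ((a n) * (((b n) * (2 * (4 * C * A / (1 - ρ)))) ^ 2 + (b n) * (4 * C * A / (1 - ρ)) ^ 2))
          / (Real.sqrt (a n) * (b n))) fun x => ?_).abs
      rw [hD]
      refine (abs_sub _ _).trans (add_le_add ?_ ?_)
      · rw [abs_mul, abs_of_nonneg (Real.sqrt_nonneg _)]
        refine mul_le_mul_of_nonneg_left ((abs_sub _ _).trans (add_le_add
          (abs_batchMeans_sigmaHat_le hC hna hbn x) le_rfl)) (Real.sqrt_nonneg _)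
      · rw [abs_div, abs_of_pos (mul_pos (Real.sqrt_pos.2 haR) hbR)]
        refine div_le_div_of_nonneg_right ((Finset.abs_sum_le_sum_abs _ _).trans ?_) (by positivity)
        calc ∑ j ∈ Finset.range (a n), |(∑ r ∈ Finset.range (b n), (h (x (b n * j + r + 1)) - kop κ h (x (b n * j + r)))) ^ 2
              - ∑ i ∈ Finset.range (b n), (kop κ (fun y => h y ^ 2) (x (b n * j + i)) - (kop κ h (x (b n * j + i))) ^ 2)|
            ≤ ∑ _j ∈ Finset.range (a n), (((b n) * (2 * (4 * C * A / (1 - ρ)))) ^ 2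
              + (b n) * (4 * C * A / (1 - ρ)) ^ 2) := Finset.sum_le_sum fun j _ => by
              refine (abs_sub _ _).trans (add_le_add ?_ ((Finset.abs_sum_le_sum_abs _ _).trans ?_))
              · rw [abs_pow]
                exact pow_le_pow_left₀ (abs_nonneg _) (abs_blockMartingale_le κ hCh _ _ x) 2
              · calc ∑ i ∈ Finset.range (b n), |(kop κ (fun y => h y ^ 2) (x (b n * j + i)) - (kop κ h (x (b n * j + i))) ^ 2)|
                    ≤ ∑ _i ∈ Finset.range (b n), (4 * C * A / (1 - ρ)) ^ 2 :=
                      Finset.sum_le_sum fun i _ => hqb _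
                  _ = (b n) * (4 * C * A / (1 - ρ)) ^ 2 := by
                      rw [Finset.sum_const, Finset.card_range, nsmul_eq_mul]
          _ = (a n) * (((b n) * (2 * (4 * C * A / (1 - ρ)))) ^ 2 + (b n) * (4 * C * A / (1 - ρ)) ^ 2) := by
              rw [Finset.sum_const, Finset.card_range, nsmul_eq_mul]
    have hcheb := mul_meas_ge_le_integral_of_nonneg (μ := P) (ae_of_all _ fun x => abs_nonneg (D x))
      hDint δ
    calc P.real {x | δ ≤ |D x|} ≤ (∫ x, |D x| ∂P) / δ := by
          rw [le_div_iff₀ hδ, mul_comm]; exact hcheb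
      _ ≤ _ := div_le_div_of_nonneg_right hL1 hδ.le
  exact tendstoInDistribution_of_tendstoInMeasure_sub _ Y hTA hdiff fun n => (hFm n).aemeasurable

end Envelope

section DoeblinPower

variable {κ : Kernel Ω Ω} [IsMarkovKernel κ] {π : Measure Ω} [IsProbabilityMeasure π]
  {ν : Measure Ω} [IsProbabilityMeasure ν] {ε : ℝ≥0∞} {m : ℕ}

/-- **THE CLT FOR THE BATCH-MEANS ESTIMATOR UNDER A DOEBLIN POWER, FROM ANY START.**  `π`
invariant, `(nHit κ m)(x, ·) ≥ ε ν` (`0 < ε ≤ 1`, `0 < m`), `|f| ≤ C` measurable; `a_n, b_n → ∞`,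
`a_n/b_n² → 0`; for every `Y ~ N(0, 2σ⁴_f)`: `√a_n (a_n b_n · SE²_BM − σ²_f) ⇒ Y`. -/
theorem chain_batchMeans_sigmaHat_clt_of_nHit (hπ : Kernel.Invariant κ π)
    (hmin : ∀ x {B : Set Ω}, MeasurableSet B → ε * ν B ≤ Exactness.nHit κ m x B) (hε0 : 0 < ε)
    (hε1 : ε ≤ 1) (hm : 0 < m)
    {f : Ω → ℝ} (hf : Measurable f) {C : ℝ} (hC : ∀ x, |f x| ≤ C)
    (μ₀ : Measure Ω) [IsProbabilityMeasure μ₀] {a b : ℕ → ℕ} (ha : Tendsto a atTop atTop)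
    (hb : Tendsto b atTop atTop) (hab : Tendsto (fun n => (a n : ℝ) / (b n : ℝ) ^ 2) atTop (𝓝 0))
    {Ω' : Type*} [MeasurableSpace Ω'] {P' : Measure Ω'} [IsProbabilityMeasure P'] {Y : Ω' → ℝ}
    (hY : HasLaw Y (gaussianReal 0 (Real.toNNReal (2 * ((∫ y, (f y - ∫ z, f z ∂π) ^ 2 ∂π)
      + 2 * ∑' k, ∫ y, (f y - ∫ z, f z ∂π)
        * (kop κ)^[k + 1] (fun y => f y - ∫ z, f z ∂π) y ∂π) ^ 2))) P')
    [IsProbabilityMeasure (Kernel.trajMeasure (X := fun _ : ℕ => Ω) (μ₀)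
          (fun n : ℕ => κ.comap (fun h' : (i : ↥(Finset.Iic n)) → Ω => h' ⟨n, Finset.mem_Iic.2 le_rfl⟩)
            (measurable_pi_apply _)))] :
    TendstoInDistribution (fun (n : ℕ) (x : ℕ → Ω) =>
        Real.sqrt (a n) * (((b n * a n : ℕ) : ℝ)
          * replicaSEsq (fun j (x : ℕ → Ω) => (∑ i ∈ Finset.range (b n), f (x (b n * j + i))) / (b n))
            (a n) x
          - ((∫ y, (f y - ∫ z, f z ∂π) ^ 2 ∂π)
            + 2 * ∑' k, ∫ y, (f y - ∫ z, f z ∂π)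
              * (kop κ)^[k + 1] (fun y => f y - ∫ z, f z ∂π) y ∂π)))
      atTop Y (fun _ => (Kernel.trajMeasure (X := fun _ : ℕ => Ω) (μ₀)
            (fun n : ℕ => κ.comap (fun h' : (i : ↥(Finset.Iic n)) → Ω => h' ⟨n, Finset.mem_Iic.2 le_rfl⟩)
              (measurable_pi_apply _)))) P' := by
  obtain ⟨A, ρ, hA, hρ0, hρ1, henv⟩ := exists_geometricEnvelope_of_nHit hmin hε0 hε1 hm hπ
  exact chain_batchMeans_sigmaHat_clt_of_envelope hπ henv hA hρ0 hρ1 hf hC μ₀ ha hb hab hY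

end DoeblinPower

end Summit.Ventures.LatticeQCDFlow.Scoring

end
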